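import Summits.Ventures.LatticeQCDFlow.Scaling.ExtensiveSpecificHeatInnovations

/-!
HONEST FRAMING: exact (Metropolis-corrected) sampling algorithms for lattice gauge theory; figures
of merit are autocorrelation/cost numbers at stated couplings and volumes; no continuum-physics
claim.

# ExtensiveSpecificHeatStaple — THE STAPLE DECOUPLING LEMMA ON THE GROUP AND THE EVEN LINK FAMILY OF
# THE TORUS (theory2 item 126, PART 3 of 4: §5–§6)

CUSTODY: theory2 item 126 (GEN-39, HOME tier) re-landed by lean-2 GEN-9 per LEAD LINE 245 RT-30 (202);
statements and proofs = HOME/lean/theory2/ExtensiveSpecificHeat.lean 21be0330075c0491 (1 051 l) verbatim,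
split below the `lint.size` line into FOUR files (`…HeatBath` §1–§2, `…Innovations` §3–§4, `…Staple`
§5–§6, `ExtensiveSpecificHeat` §7); headers trimmed; landing edits: docstrings added where the lint asks.

This part: §5 the STAPLE DECOUPLING LEMMA (`staple_decoupling`): along a two-link fibre `(h, g)` a function
of the form `T(h,g) = A(h) − φ(h · a g b) + c(g)` has `∫∫ (T − ∫T dh)² ≥ ∫ (φ − ∫φ)²` (expand the square,
Fubini, translation invariance of Haar); §6 torus geometry in direction `0`: the even family
`M = {(x,0) : x_j even, j ≥ 1}` (`evenSites`, `|M| = L⌊L/2⌋^{n+1}`, pairwise disjoint plaquette sets,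
`disjoint_plaqsThrough_dir0`) and the staple link / base plaquette (`basePlaq`).
-/

noncomputable section

set_option linter.unusedSectionVars false

namespace Summit.Ventures.LatticeQCDFlow.Theory2.ExtensiveSpecificHeat

open MeasureTheory ProbabilityTheory Literature.MathematicalPhysics.QuantumFieldTheory
open Summit.Ventures.LatticeQCDFlow.TrivializingMaps
open scoped ENNReal

/-! ## §5 The staple DECOUPLING LEMMA on the group -/

section Decoupling

variable {G : Type*} [Group G] [TopologicalSpace G] [IsTopologicalGroup G]
  [CompactSpace G] [MeasurableSpace G] [BorelSpace G] [SecondCountableTopology G]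

/-- `∫ (u − w)² = ∫ u² − 2 ∫ u·w + ∫ w²` for continuous `u, w` on the compact group. -/
theorem integral_sub_sq_expand {μ : Measure G} [IsFiniteMeasure μ] {u w : G → ℝ}
    (hu : Continuous u) (hw : Continuous w) :
    ∫ x, (u x - w x) ^ 2 ∂μ
      = ∫ x, (u x) ^ 2 ∂μ - 2 * ∫ x, u x * w x ∂μ + ∫ x, (w x) ^ 2 ∂μ := by
  have h1 : Integrable (fun x => (u x) ^ 2) μ := integrable_of_continuous_group (hu.pow 2)
  have h2 : Integrable (fun x => 2 * (u x * w x)) μ :=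
    (integrable_of_continuous_group (hu.mul hw)).const_mul 2
  have h3 : Integrable (fun x => (w x) ^ 2) μ := integrable_of_continuous_group (hw.pow 2)
  calc ∫ x, (u x - w x) ^ 2 ∂μ
      = ∫ x, ((u x) ^ 2 - 2 * (u x * w x) + (w x) ^ 2) ∂μ := by
        refine integral_congr_ae (ae_of_all _ fun x => ?_); simp only; ring
    _ = ∫ x, (u x) ^ 2 ∂μ - 2 * ∫ x, u x * w x ∂μ + ∫ x, (w x) ^ 2 ∂μ := by
        rw [integral_add (h1.sub' h2) h3, integral_sub h1 h2, integral_const_mul]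

/-- **DECOUPLING LEMMA.** Let `T(h,g) = A(h) − φ(h·(a g b)) + c(g)` with `A, φ` continuous. Then the
`g`-average (Haar) of the `h`-variance (Haar) of `T(·,g)` is at least the Haar variance of `φ`:
the cross term between `A` and `φ(h a g b)` vanishes after the `g`-integration (left and right
invariance of Haar), and the `A`-variance is nonnegative. -/
theorem staple_decoupling {T : G → G → ℝ} {A c φ : G → ℝ} (hA : Continuous A)
    (hφ : Continuous φ) (a b : G) (hT : ∀ h g, T h g = A h - φ (h * (a * g * b)) + c g) :
    ∫ g, (φ g - ∫ g', φ g' ∂haarProbability G) ^ 2 ∂haarProbability G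
      ≤ ∫ g, ∫ h, (T h g - ∫ h', T h' g ∂haarProbability G) ^ 2 ∂haarProbability G
          ∂haarProbability G := by
  obtain ⟨Abar, hAbar⟩ : ∃ x : ℝ, x = ∫ h, A h ∂haarProbability G := ⟨_, rfl⟩
  obtain ⟨φbar, hφbar⟩ : ∃ x : ℝ, x = ∫ g, φ g ∂haarProbability G := ⟨_, rfl⟩
  rw [← hφbar]
  have hφm : ∀ g : G, Continuous fun h : G => φ (h * (a * g * b)) := fun g =>
    hφ.comp (continuous_id.mul continuous_const)
  have hiA : Integrable A (haarProbability G) := integrable_of_continuous_group hA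
  -- (i) the fibre mean
  have hmean : ∀ g, ∫ h', T h' g ∂haarProbability G = Abar - φbar + c g := by
    intro g
    simp_rw [hT]
    rw [integral_add (hiA.sub' (integrable_of_continuous_group (hφm g))) (integrable_const _),
      integral_sub hiA (integrable_of_continuous_group (hφm g)),
      integral_mul_right_eq_self (μ := haarProbability G) φ (a * g * b),
      integral_const, smul_eq_mul, probReal_univ, one_mul, hAbar, hφbar]
  -- (ii) the inner (h-) integral, for each g
  have hinner : ∀ g, ∫ h, (T h g - ∫ h', T h' g ∂haarProbability G) ^ 2 ∂haarProbability G
      = ∫ h, (A h - Abar) ^ 2 ∂haarProbability G + ∫ y, (φ y - φbar) ^ 2 ∂haarProbability G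
        - 2 * ∫ h, (A h - Abar) * (φ (h * (a * g * b)) - φbar) ∂haarProbability G := by
    intro g
    have hT' : ∀ h, T h g - ∫ h', T h' g ∂haarProbability G
        = (A h - Abar) - (φ (h * (a * g * b)) - φbar) := by
      intro h; rw [hmean g, hT]; ring
    simp_rw [hT']
    rw [integral_sub_sq_expand (μ := haarProbability G) (u := fun h => A h - Abar)
        (w := fun h => φ (h * (a * g * b)) - φbar) (hA.sub continuous_const)
        ((hφm g).sub continuous_const),
      integral_mul_right_eq_self (μ := haarProbability G) (fun y => (φ y - φbar) ^ 2) (a * g * b)]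
    ring
  -- (iii) the cross term vanishes after the g-integration
  have hF : Continuous (Function.uncurry fun (g h : G) =>
      (A h - Abar) * (φ (h * (a * g * b)) - φbar)) :=
    ((hA.comp continuous_snd).sub continuous_const).mul
      ((hφ.comp (continuous_snd.mul ((continuous_const.mul continuous_fst).mul
        continuous_const))).sub continuous_const)
  have hX : Continuous fun g : G =>
      ∫ h, (A h - Abar) * (φ (h * (a * g * b)) - φbar) ∂haarProbability G := by
    have h := continuous_parametric_integral_of_continuous (μ := haarProbability G) hF
      isCompact_univ
    simp only [Measure.restrict_univ] at h
    exact h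
  have hcross : ∫ g, ∫ h, (A h - Abar) * (φ (h * (a * g * b)) - φbar) ∂haarProbability G
      ∂haarProbability G = 0 := by
    have hint : Integrable (Function.uncurry fun (g h : G) =>
        (A h - Abar) * (φ (h * (a * g * b)) - φbar))
        ((haarProbability G).prod (haarProbability G)) :=
      hF.integrable_of_hasCompactSupport (HasCompactSupport.of_compactSpace _)
    rw [integral_integral_swap hint]
    have hin : ∀ h : G,
        ∫ g, (A h - Abar) * (φ (h * (a * g * b)) - φbar) ∂haarProbability G = 0 := by
      intro h
      have hshift : ∫ g, φ (h * (a * g * b)) ∂haarProbability G = ∫ g, φ g ∂haarProbability G := by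
        have e1 : (fun g => φ (h * (a * g * b))) = fun g => (fun y => φ (h * a * y)) (g * b) := by
          funext g; simp only [mul_assoc]
        rw [e1, integral_mul_right_eq_self (μ := haarProbability G) (fun y => φ (h * a * y)) b]
        exact integral_mul_left_eq_self (μ := haarProbability G) φ (h * a)
      rw [integral_const_mul, integral_sub (integrable_of_continuous_group
          (φ := fun g => φ (h * (a * g * b)))
          (hφ.comp (continuous_const.mul ((continuous_const.mul continuous_id).mul
            continuous_const))))
          (integrable_const _),
        hshift, integral_const, smul_eq_mul, probReal_univ, one_mul, ← hφbar, sub_self, mul_zero]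
    simp [hin]
  -- (iv) assemble
  have hVA : 0 ≤ ∫ h, (A h - Abar) ^ 2 ∂haarProbability G := integral_nonneg fun _ => sq_nonneg _
  have hiX : Integrable (fun g => 2 * ∫ h, (A h - Abar) * (φ (h * (a * g * b)) - φbar)
      ∂haarProbability G) (haarProbability G) := (integrable_of_continuous_group hX).const_mul 2
  calc ∫ g, (φ g - φbar) ^ 2 ∂haarProbability G
      ≤ (∫ h, (A h - Abar) ^ 2 ∂haarProbability G + ∫ y, (φ y - φbar) ^ 2 ∂haarProbability G)
          - 2 * 0 := by linarith
    _ = ∫ g, ((∫ h, (A h - Abar) ^ 2 ∂haarProbability G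
          + ∫ y, (φ y - φbar) ^ 2 ∂haarProbability G)
          - 2 * ∫ h, (A h - Abar) * (φ (h * (a * g * b)) - φbar) ∂haarProbability G)
            ∂haarProbability G := by
        rw [integral_sub (integrable_const _) hiX, integral_const_mul, hcross, integral_const,
          smul_eq_mul, probReal_univ, one_mul]
    _ = ∫ g, ∫ h, (T h g - ∫ h', T h' g ∂haarProbability G) ^ 2 ∂haarProbability G
          ∂haarProbability G := by
        refine integral_congr_ae (ae_of_all _ fun g => ?_); simp only; rw [hinner g]

end Decoupling

/-! ## §6 Torus geometry in direction `0`: the even family and the staple link -/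

section Geometry

variable {n L : ℕ} [NeZero L]

/-- The even residues `{0, 2, …, 2(⌊L/2⌋ − 1)} ⊂ ℤ/L`. -/
def evenRes (L : ℕ) [NeZero L] : Finset (ZMod L) :=
  (Finset.range (L / 2)).image fun m : ℕ => ((2 * m : ℕ) : ZMod L)

/-- `#evenRes L = ⌊L/2⌋`. [folklore] -/
theorem card_evenRes : (evenRes L).card = L / 2 := by
  unfold evenRes
  rw [Finset.card_image_of_injOn, Finset.card_range]
  intro m hm m' hm' hmm'
  simp only [Finset.coe_range, Set.mem_Iio] at hm hm'
  have h1 : 2 * m < L := by omega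
  have h2 : 2 * m' < L := by omega
  have h := (ZMod.natCast_eq_natCast_iff' (2 * m) (2 * m') L).1 hmm'
  rw [Nat.mod_eq_of_lt h1, Nat.mod_eq_of_lt h2] at h
  omega

/-- No two consecutive residues are both even residues (this uses `2⌊L/2⌋ ≤ L`). -/
theorem succ_not_mem_evenRes {r : ZMod L} (hr : r ∈ evenRes L) : r + 1 ∉ evenRes L := by
  intro hr1
  unfold evenRes at hr hr1
  simp only [Finset.mem_image, Finset.mem_range] at hr hr1
  obtain ⟨m, hm, rfl⟩ := hr
  obtain ⟨m', hm', hmm'⟩ := hr1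
  have h1 : 2 * m + 1 < L := by omega
  have h2 : 2 * m' < L := by omega
  have h : ((2 * m' : ℕ) : ZMod L) = ((2 * m + 1 : ℕ) : ZMod L) := by rw [hmm']; push_cast; ring
  have h' := (ZMod.natCast_eq_natCast_iff' _ _ _).1 h
  rw [Nat.mod_eq_of_lt h2, Nat.mod_eq_of_lt h1] at h'
  omega

/-- The sites all of whose coordinates `j ≠ 0` are even residues. -/
def evenSites (n L : ℕ) [NeZero L] : Finset (Site (n + 2) L) :=
  Fintype.piFinset fun j : Fin (n + 2) => if j = 0 then Finset.univ else evenRes L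

/-- `#evenSites = L·⌊L/2⌋^{n+1}`. [folklore] -/
theorem card_evenSites : (evenSites n L).card = L * (L / 2) ^ (n + 1) := by
  unfold evenSites
  rw [Fintype.card_piFinset, Fin.prod_univ_succ]
  simp only [if_true, Fin.succ_ne_zero, if_false, Finset.card_univ, ZMod.card,
    Finset.prod_const, Fintype.card_fin, card_evenRes]

/-- Coordinates `j ≥ 1` of an even site are even residues. [folklore] -/
theorem mem_evenSites {x : Site (n + 2) L} (hx : x ∈ evenSites n L) {j : Fin (n + 2)}
    (hj : j ≠ 0) : x j ∈ evenRes L := by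
  have h := (Fintype.mem_piFinset.1 hx) j
  simpa [hj] using h

/-- `(x.shift j) j = x j + 1`. [folklore] -/
theorem shift_apply_same (x : Site (n + 2) L) (j : Fin (n + 2)) : (x.shift j) j = x j + 1 := by
  simp [Site.shift]

/-- A double shift in two different directions moves every site (`L ≥ 2`). -/
theorem shift_shift_ne_self (hL : 2 ≤ L) (x : Site (n + 2) L) {i j : Fin (n + 2)} (hij : i ≠ j) :
    (x.shift i).shift j ≠ x := by
  haveI : Fact (1 < L) := ⟨by omega⟩
  intro h
  have h1 := congrFun h i
  simp [Site.shift, hij] at h1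

/-- A plaquette through the direction-`0` link at `x` lies in a `(0, b)` plane and has `x` as its
base point or as its `b`-shifted base point. -/
theorem mem_plaqsThrough_dir0 {x : Site (n + 2) L} {q : Plaquette (n + 2) L}
    (hq : q ∈ plaqsThrough ((x, 0) : Edge (n + 2) L)) :
    q.2.1.1 = 0 ∧ (q.1 = x ∨ x = q.1.shift q.2.1.2) := by
  obtain ⟨y, ⟨a', b'⟩, hab⟩ := q
  have hb0 : b' ≠ 0 := by
    intro h
    have h' := Fin.lt_def.1 hab
    rw [h, Fin.val_zero] at h'
    omega
  rw [mem_plaqsThrough] at hq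
  simp only [plaqEdgesT, Finset.mem_insert, Finset.mem_singleton, Prod.mk.injEq] at hq
  rcases hq with ⟨h1, h2⟩ | ⟨h1, h2⟩ | ⟨h1, h2⟩ | ⟨h1, h2⟩
  · exact ⟨h2.symm, Or.inl h1.symm⟩
  · exact absurd h2.symm hb0
  · exact ⟨h2.symm, Or.inr h1⟩
  · exact absurd h2.symm hb0

/-- **(G1)** Direction-`0` links at two different even sites have DISJOINT plaquette sets. -/
theorem disjoint_plaqsThrough_dir0 {x x' : Site (n + 2) L} (hx : x ∈ evenSites n L)
    (hx' : x' ∈ evenSites n L) (hne : x ≠ x') :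
    Disjoint (plaqsThrough ((x, 0) : Edge (n + 2) L)) (plaqsThrough ((x', 0) : Edge (n + 2) L)) := by
  rw [Finset.disjoint_left]
  intro q hq hq'
  obtain ⟨ha, h1⟩ := mem_plaqsThrough_dir0 hq
  obtain ⟨-, h2⟩ := mem_plaqsThrough_dir0 hq'
  have hb0 : q.2.1.2 ≠ 0 := by
    intro h
    have h' := Fin.lt_def.1 q.2.2
    rw [h, ha, Fin.val_zero] at h'
    omega
  rcases h1 with h1 | h1 <;> rcases h2 with h2 | h2
  · exact hne (h1.symm.trans h2)
  · have hs : x' q.2.1.2 = x q.2.1.2 + 1 := by rw [h2, h1, shift_apply_same]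
    exact succ_not_mem_evenRes (mem_evenSites hx hb0) (hs ▸ mem_evenSites hx' hb0)
  · have hs : x q.2.1.2 = x' q.2.1.2 + 1 := by rw [h1, h2, shift_apply_same]
    exact succ_not_mem_evenRes (mem_evenSites hx' hb0) (hs ▸ mem_evenSites hx hb0)
  · exact hne (h1.trans h2.symm)

/-- The base plaquette `p₀ = (x; 0, 1)` of the site `x`. -/
def basePlaq (x : Site (n + 2) L) : Plaquette (n + 2) L :=
  (x, ⟨((0 : Fin (n + 2)), 1), Fin.zero_lt_one⟩)

/-- **(G2)** The staple link `(x + e₀, 1)` lies on exactly one plaquette through `(x, 0)`, namely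
`p₀ = (x; 0, 1)`. -/
theorem not_mem_plaqsThrough_staple (hL : 2 ≤ L) (x : Site (n + 2) L) {q : Plaquette (n + 2) L}
    (hq : q ∈ plaqsThrough ((x, 0) : Edge (n + 2) L))
    (hne : q ≠ (x, ⟨((0 : Fin (n + 2)), 1), Fin.zero_lt_one⟩)) :
    q ∉ plaqsThrough ((x.shift 0, 1) : Edge (n + 2) L) := by
  have h10 : (1 : Fin (n + 2)) ≠ 0 := Fin.zero_lt_one.ne'
  obtain ⟨ha, hy⟩ := mem_plaqsThrough_dir0 hq
  obtain ⟨y, ⟨a', b'⟩, hab⟩ := q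
  simp only at ha hy hne
  subst ha
  intro hmem
  rw [mem_plaqsThrough] at hmem
  simp only [plaqEdgesT, Finset.mem_insert, Finset.mem_singleton, Prod.mk.injEq] at hmem
  rcases hmem with ⟨h1, h2⟩ | ⟨h1, h2⟩ | ⟨h1, h2⟩ | ⟨h1, h2⟩
  · exact h10 h2
  · apply hne
    have hxy : x = y := by
      simp only [Site.shift] at h1
      exact add_right_cancel h1
    subst hxy; subst h2; rfl
  · exact h10 h2
  · rcases hy with hy | hy
    · exact site_shift_ne_self_of_two_le hL x 0 (h1.trans hy)
    · subst h2
      rw [← h1] at hy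
      exact shift_shift_ne_self hL x Fin.zero_lt_one.ne hy.symm

/-- **(G3)** `p₀ = (x; 0, 1)` is a plaquette through `(x, 0)`. -/
theorem basePlaq_mem_plaqsThrough (x : Site (n + 2) L) :
    ((x, ⟨((0 : Fin (n + 2)), 1), Fin.zero_lt_one⟩) : Plaquette (n + 2) L)
      ∈ plaqsThrough ((x, 0) : Edge (n + 2) L) := by
  rw [mem_plaqsThrough]
  simp [plaqEdgesT]

/-- **(G4)** Left-multiplying the SECOND link `(x + eᵢ, j)` of the plaquette `(x; i, j)` conjugates
the inserted element by `U(x,i)`: `P(g ·_{(x+eᵢ,j)} U) = U(x,i) g U(x,i)⁻¹ · P(U)`. -/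
theorem plaquetteHolonomy_mulSingle_second {d : ℕ} {G : Type*} [Group G] [DecidableEq (Edge d L)]
    (hL : 2 ≤ L) (U : GaugeConfig d L G) (x : Site d L) {i j : Fin d} (hij : i ≠ j) (g : G) :
    plaquetteHolonomy (Pi.mulSingle (x.shift i, j) g * U) x i j
      = U (x, i) * g * (U (x, i))⁻¹ * plaquetteHolonomy U x i j := by
  have h1 : ((x, i) : Edge d L) ≠ (x.shift i, j) := fun e => hij (congrArg Prod.snd e)
  have h2 : ((x.shift j, i) : Edge d L) ≠ (x.shift i, j) := fun e => hij (congrArg Prod.snd e)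
  have h3 : ((x, j) : Edge d L) ≠ (x.shift i, j) := fun e =>
    site_shift_ne_self_of_two_le hL x i (congrArg Prod.fst e).symm
  simp only [plaquetteHolonomy, Pi.mul_apply, Pi.mulSingle_eq_same, Pi.mulSingle_eq_of_ne h1,
    Pi.mulSingle_eq_of_ne h2, Pi.mulSingle_eq_of_ne h3, one_mul]
  group

end Geometry

end Summit.Ventures.LatticeQCDFlow.Theory2.ExtensiveSpecificHeat
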